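import Mathlib
import Literature.MeasureTheory.Integral.WidderLaplaceRepresentation
import HarnessLib

/-!
# A positive measure on `[0,∞)` with finite Laplace transform is determined by it (σ-finite uniqueness)

The uniqueness half of Bernstein–Widder for possibly INFINITE representing measures: two positive measures `μ, ν` on `ℝ`
carried by `[0,∞)` whose Laplace transforms `∫ e^{-tE}` are finite and agree for all `t > 0` coincide
(`measure_eq_of_lintegral_laplace_eq`).  Proof: the tilted measures `e^{-E}μ`, `e^{-E}ν` are finite with equal Laplace
values at `0, 1, 2, …`, hence equal (`measure_eq_of_lintegral_exp_neg_nat_mul_eq`, Hausdorff–Weierstrass), and the tilt is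
undone by the density `e^{E}`.  [cite: Widder1941, Ch. II §6 Thm. 6.3 (uniqueness of the Laplace–Stieltjes transform)]
[cite: BergChristensenRessel1984, Ch. 4 Prop. 6.11]

THEOREMS ONLY; no `sorry`; standard axioms.  (The tree's `Literature.MeasureTheory.Integral.LaplaceTransformUnique` states the
same uniqueness with hypotheses at `t = 1, 2, …`; it is currently not built on the farm, and the form below — real `t > 0`,
one integrability hypothesis — is the one consumed by the Laplace–Fourier assembly for crux ⟨stmt-QuantumFields-23125⟩.)
-/

noncomputable section

open MeasureTheory Set Filter Topology
open scoped ENNReal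

namespace Literature.MeasureTheory.Integral

/-- **Uniqueness of the representing measure (σ-finite form).**  Two measures on `ℝ` carried by `[0,∞)` with
`∫ e^{-E} dμ, ∫ e^{-E} dν < ∞` and equal Laplace transforms `∫⁻ e^{-tE}` for all `t > 0` are equal.
[cite: Widder1941, Ch. II §6 Thm. 6.3] [cite: BergChristensenRessel1984, Ch. 4 Prop. 6.11] -/
theorem measure_eq_of_lintegral_laplace_eq {μ ν : Measure ℝ} (hμ0 : μ (Iio 0) = 0) (hν0 : ν (Iio 0) = 0)
    (hμ1 : ∫⁻ E, ENNReal.ofReal (Real.exp (-E)) ∂μ ≠ ∞) (hν1 : ∫⁻ E, ENNReal.ofReal (Real.exp (-E)) ∂ν ≠ ∞)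
    (h : ∀ t : ℝ, 0 < t →
      ∫⁻ E, ENNReal.ofReal (Real.exp (-(t * E))) ∂μ = ∫⁻ E, ENNReal.ofReal (Real.exp (-(t * E))) ∂ν) :
    μ = ν := by
  -- the densities `e^{-E}` and `e^{E}`
  set dn : ℝ → ℝ≥0∞ := fun E => ENNReal.ofReal (Real.exp (-E)) with hdn
  set dp : ℝ → ℝ≥0∞ := fun E => ENNReal.ofReal (Real.exp E) with hdp
  have hdn_meas : Measurable dn := (Real.measurable_exp.comp measurable_neg).ennreal_ofReal
  have hdp_meas : Measurable dp := Real.measurable_exp.ennreal_ofReal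
  have hmul : dn * dp = 1 := by
    funext E
    simp only [Pi.mul_apply, Pi.one_apply, hdn, hdp]
    rw [← ENNReal.ofReal_mul (Real.exp_pos _).le, ← Real.exp_add, neg_add_cancel, Real.exp_zero, ENNReal.ofReal_one]
  have huntilt : ∀ ρ : Measure ℝ, (ρ.withDensity dn).withDensity dp = ρ := fun ρ => by
    rw [← withDensity_mul _ hdn_meas hdp_meas, hmul, withDensity_one]
  -- the tilted measures are finite, carried by `[0,∞)`, with equal Laplace values at the naturals
  haveI hfinμ : IsFiniteMeasure (μ.withDensity dn) :=
    ⟨by rw [withDensity_apply _ MeasurableSet.univ, Measure.restrict_univ]; exact lt_top_iff_ne_top.2 hμ1⟩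
  haveI hfinν : IsFiniteMeasure (ν.withDensity dn) :=
    ⟨by rw [withDensity_apply _ MeasurableSet.univ, Measure.restrict_univ]; exact lt_top_iff_ne_top.2 hν1⟩
  have htilt : ∀ (ρ : Measure ℝ) (n : ℕ), ∫⁻ E, ENNReal.ofReal (Real.exp (-(n * E))) ∂(ρ.withDensity dn) =
      ∫⁻ E, ENNReal.ofReal (Real.exp (-(((n : ℝ) + 1) * E))) ∂ρ := by
    intro ρ n
    have hm : Measurable fun E : ℝ => ENNReal.ofReal (Real.exp (-((n : ℝ) * E))) :=
      ((measurable_id.const_mul (n : ℝ)).neg.exp).ennreal_ofReal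
    rw [lintegral_withDensity_eq_lintegral_mul _ hdn_meas hm]
    refine lintegral_congr fun E => ?_
    simp only [Pi.mul_apply, hdn]
    rw [← ENNReal.ofReal_mul (Real.exp_pos _).le, ← Real.exp_add]
    congr 2; ring
  have heq : μ.withDensity dn = ν.withDensity dn := by
    refine measure_eq_of_lintegral_exp_neg_nat_mul_eq (withDensity_absolutelyContinuous _ _ hμ0)
      (withDensity_absolutelyContinuous _ _ hν0) fun n => ?_
    rw [htilt, htilt]
    exact h _ (by positivity)
  rw [← huntilt μ, ← huntilt ν, heq]

end Literature.MeasureTheory.Integral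

end
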